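import Summits.QuantumFields.YangMills.Theorems.BalabanUVNodesN26AtRecord13
import Literature.MathematicalPhysics.QuantumFieldTheory.Balaban1983to89.Beta.RemainderData190TowerFlat

/-!
# DAG node N26 ∕ row (D4) — NODE D SUPPLIED AT RECORD 13 IN def-B13's FAMILY CURRENCY: dag-n26-c's Stage-13 family chain
# `…N26AtRecord13.exists_chainTFac190H_betaOfRecord₁₃_of_family` (p491248 §1b) and its three consumers WITH THE (190)-DATUM CONSTRUCTED,
# LETTER-FREE, FROM NE9's FLAT TOWER OPERATOR `H₁,k(1)` ON THE MEMBERS' OWN TORI («Y19» at `N := NOfLayers (m ↦ lamF (Ps k v m) k v)`) —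
# the Record-13 twin of the row-(D4) owner's `…N26AtRecord12B13FamilyTowerFlat` (p478901)

Cell pub-balaban, β-function sub-cell, BINDER row (D4) OWNER lineage `b2b-balaban-beta-an4` (gen 126; memo
`HOME/b2b-balaban-beta-an4/FLAT-LETTERS-LOCATED.md` §37).  Context: director-ym LINE №125 «RECORD 13» (`Node00/Record13.lean` v1.1 p488788:
`Stage13Params extends Stage12Params` + `ε₂₉`; `betaOfRecord₁₃ θ = betaOfMerged βm₁₃ (beta0OfMerged βm₁₃ θ.v₀) θ.γ` over the canonical transport
`TcanOfRecord` and the (2.9) species `chiFixed29 θ.ν θ.ε₂₉`); plan g66 rev 16∕17 (crux K2‴ `EndpointGivenBR13` = stmt-QuantumFields-19911, the ₁₂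
text re-keyed); dag-lead KEY TABLE WORDS-133 («N26 (D4) chain → `--supports 19911`»); dag-n26-c g5∕g6 p491248 `…N26AtRecord13` (the first N26 face at
Record 13; §1b = p478229 §1 re-keyed at the ₁₃ merged β, the (D4) chain built inline over the row-(D4) owner's adapter `polLeavesTFac190H_ofRecordB13`
with `D : Data190 4 M (NOfLayers fun m => lamF (Ps k v m) k v) (Wn k v) q` DISPLAYED).

WHY THIS FILE.  Exactly as at Stage 12 (p478901 over p478229): p491248 §1b takes, per (scale, history) in the box, NODE D's (190)-datum `D k v` on the
tori of the run sequence's members at that history as a displayed hypothesis on arbitrary (4.4)-spaces `Wn k v`; «Y19»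
`Beta.RemainderData190TowerFlat.exists_data190_tower_flat` (this lineage, gen 115) INHABITS that socket for EVERY torus sequence on the fine bond
fields of NE9's (k+1)-storey tower at zero background, thresholds `(δ⋆, C⋆)` of the structure data first, numerics on `q` only, with the (4.35)
computation rule of its test vectors exposed.  The members' tori `NOfLayers (m ↦ lamF (Ps k v m) k v)` ARE such a sequence, so the junction is one
`choose` and four applications BY NAME — §1 `exists_chainTFac190H_betaOfRecord₁₃_of_family_towerFlat`: p491248 §1b's four readings (chain with
handles ∕ the rows-(D4) ∧ B4 residue at the ₁₃ split from (C-leaf) ∕ B4 at `betaOfRecord₁₃ θ` ∕ N26 at the ₁₃ datum) with `Wn k v m :=` the tower's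
fine bond fields and `D k v :=` «Y19» at the members' tori, the consumer's `hconv` READ ON THE EXPLICIT FLAT VECTORS.  The record-GENERIC form of
this supply (any split `S : OneLoopSplit β`, any `θ₃ : Stage3Params`, layer-sequence currency) is the same gen's `…N26AtSplitB13LayersTowerFlat`;
this file is the by-name face at the record of record in the currency K2‴'s helpers use (def-B13's Stage-12 family, letters of record).

HONEST FRAMING.  Compositions BY NAME (0 `def`, 0 `sorry`; one `choose` over «Y19» per (k, v) and p491248's four theorems); NO estimate is proved
here and nothing of Bałaban's is constructed beyond NE9's flat tower operator.  NODE D is supplied on the MODEL CLASS of «Y19» — zero background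
(`□₀ = 1`, `Δ⁽²⁾(1) = 0`), the one-domain tower `Ω_k = T_η` of height `k + 1` over the member's coarse torus, the VALUE line of (190) only, ONE unit
source per unit-lattice site; whether Bałaban's (4.35) test vectors of the record's (k+1)-st step ARE these is the term-tower-of-record identification
(def-T's `TermTowerOfRecord`, absent) — NOT asserted.  STILL DISPLAYED: the (1.22) identification `hm` at the ₁₃ merged β (NODE O), the Stage-12
family with N10's family leaf + member letters law (NODE 00 ∕ A; a ₁₃ family currency — dag-n10-d's `Node00/Record13Carriers` — re-points these
by name when def-B13 ∕ n26-c move), run sequences with `n ↗` ∕ laws ∕ `Restr` (NODE O ∕ 00), the (4.4) seams FROM THE TOWER's FINE BOND FIELDS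
with holomorphic activities (NODE B), the (1.7)∕(1.21) data with `hconv` and the read-out (NODE E), (C-pt)∕(C-leaf), N1∕N3 at the letters of
record — VACUOUS at any witness with κ ≤ 128 (n26-c p479720 §2 ∕ dag-ref-D READ-148), meaningful for free θ.  (D4) INSTANCE 0∕1, D4 DISCHARGE NO
DATE; K2‴ NOT proved (no registered ₁₃ stub text is read here); N25 ∕ N26 NOT discharged; counts unmoved.  One finite four-torus programme at fixed
ε per run — NOT the continuum limit, NOT ℝ⁴, NOT infinite volume, NOT OS, NOT a mass gap, NOT Clay.  No `instance`, no `notation`, no `axiom`.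
Sources (context): [I] = [Balaban1987RG1] CMP **109** (1987): (1.7) p. 261, (1.20)–(1.22) p. 264, (2.9) p. 266, (4.4) p. 281, p. 282, (4.35)
p. 290, (5.1) p. 292, (5.10) p. 293; [II] = [Balaban1988RG2Cluster] CMP **116** (1988): (2.13) p. 14, p. 15, Lemma 3 (2.38) p. 20, p. 21;
[15] = [Balaban1985Variational] CMP **102** (1985): (129)–(130) p. 297, (190) p. 308; [5] = [Balaban1985BackgroundPropagators] CMP **99**
(1985): (3.126) p. 420, (3.133)–(3.134) p. 422, Thm 3.11 p. 416; [3] = [Balaban1984PropagatorsII] CMP **96** (1984): (1.103) p. 36, Lemma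
2.1 (2.61) p. 234.
-/

noncomputable section

open scoped Matrix.Norms.L2Operator InnerProductSpace ComplexConjugate

namespace Summit.QuantumFields.YangMills.Theorems.BalabanUVNodesN26AtRecord13FamilyTowerFlat

open Literature.MathematicalPhysics.QuantumFieldTheory.Balaban1983to89
open Literature.MathematicalPhysics.QuantumFieldTheory.Balaban1983to89.FlowStep
open Literature.MathematicalPhysics.QuantumFieldTheory.Balaban1983to89.T4Continuum (T4Family)
open Literature.MathematicalPhysics.QuantumFieldTheory.Balaban1983to89.Node00
open Literature.MathematicalPhysics.QuantumFieldTheory.Balaban1983to89.B13ScaleTransfer (Pt)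
open Literature.MathematicalPhysics.QuantumFieldTheory.Balaban1983to89.TreeLengthTorus (TPt TDom proj)
open Literature.MathematicalPhysics.QuantumFieldTheory.Balaban1983to89.B4Sect5Torus (TSite)
open Literature.MathematicalPhysics.QuantumFieldTheory.Balaban1983to89.B12Decay510 (mixedDeriv)
open Literature.MathematicalPhysics.QuantumFieldTheory.Balaban1983to89.B12Decay510Torus (tcubeOf)
open Literature.MathematicalPhysics.QuantumFieldTheory.Balaban1983to89.B9SectCLatticeCarrier (Bond bpos)
open Literature.MathematicalPhysics.QuantumFieldTheory.Balaban1983to89.B9Eq311L2Pairing (WL2)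
open Literature.MathematicalPhysics.QuantumFieldTheory.Balaban1983to89.B9Eq315QTower (towerP UlevOf)
open Literature.MathematicalPhysics.QuantumFieldTheory.Balaban1983to89.B9Eq315QTorus (perCfg cornerSite)
open Literature.MathematicalPhysics.QuantumFieldTheory.Balaban1983to89.B9Eq319QprimeTorus (blockCoord)
open Literature.MathematicalPhysics.QuantumFieldTheory.Balaban1983to89.B9Eq316TowerFlatIsOneStep (siteCast towerP_eq_fineP_pow)
open Literature.MathematicalPhysics.QuantumFieldTheory.Balaban1983to89.B7Prop1Explicit (U1 Wcx boxVec)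
open Literature.MathematicalPhysics.QuantumFieldTheory.Balaban1983to89.B7Prop2Explicit (c2')
open Literature.MathematicalPhysics.QuantumFieldTheory.Balaban1983to89.B11Eq103H1Complex (BondL2K)
open Literature.MathematicalPhysics.QuantumFieldTheory.Balaban1983to89.B9Eq326OperatorTower (laplaceAk H1k)
open Literature.MathematicalPhysics.QuantumFieldTheory.Balaban1983to89.Beta.RemainderChainLattice
open Literature.MathematicalPhysics.QuantumFieldTheory.Balaban1983to89.Beta.RemainderLimitTorus (LDom limKernel tproj)
open Literature.MathematicalPhysics.QuantumFieldTheory.Balaban1983to89.Beta.RemainderDecay190 (Consts190 Data190)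
open Literature.MathematicalPhysics.QuantumFieldTheory.Balaban1983to89.Beta.RemainderDecay190HoloChain (ChainTFac190H)
open Literature.MathematicalPhysics.QuantumFieldTheory.Balaban1983to89.Beta.RemainderWOfRecordB13 (SpLaw Law213 NOfLayers)
open Literature.MathematicalPhysics.QuantumFieldTheory.Balaban1983to89.Beta.RemainderData190TowerFlat (exists_data190_tower_flat)
open Summit.QuantumFields.BalabanUV.Gaps
open Summit.QuantumFields.BalabanUV.Gaps.BetaContFromD4Chain
open Summit.QuantumFields.YangMills.Theorems.BalabanUVNodesN26AtRecord13
  (exists_chainTFac190H_betaOfRecord₁₃_of_family atSlopeCont_betaOfRecord₁₃_of_family_leafwise betaContH_betaOfRecord₁₃_of_family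
    n26_datumOfRecord₁₃_of_family)
open Metric Filter Topology

variable (F : T4Family) (N : ℕ) [NeZero N]

/-! ## §1 The family form at Record 13: p491248 §1b's four readings with NODE D := NE9's flat tower operator on the members' tori («Y19» at `N := NOfLayers (m ↦ lamF (Ps k v m) k v)`) -/

section FamilyTowerFlat

-- NE9's tower structure data ([5] §3 ∕ [15]: block size `L ≥ 3`, the C⋆-algebra `𝔸`, its Hilbert model `W ≃ 𝔸`, the trace `τ`, `a, a′, ρ_w, A_Q`)
variable (L : ℕ) [NeZero L] (hL : 1 ≤ L) (hL3 : 3 ≤ L)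
  {𝔸 : Type*} [CStarAlgebra 𝔸] [Nontrivial 𝔸]
  {W : Type} [NormedAddCommGroup W] [InnerProductSpace ℂ W] [FiniteDimensional ℂ W] (φ : W ≃ₗ[ℂ] 𝔸)
  {Mφ Mφ' : ℝ} (hMφ : 0 ≤ Mφ) (hMφ' : 0 ≤ Mφ') (hφ : ∀ w, ‖φ w‖ ≤ Mφ * ‖w‖) (hφ' : ∀ X, ‖φ.symm X‖ ≤ Mφ' * ‖X‖)
  {a₁ : ℝ} (ha₁ : 0 < a₁) {a₁' : ℝ} (ha₁' : 0 < a₁')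
  (τ : 𝔸 →ₗ[ℂ] ℂ) {Cτ : ℝ} (hτ : ∀ X, ‖τ X‖ ≤ Cτ * ‖X‖) (hCτ : 0 ≤ Cτ) {Mτ : ℝ}
  (hτm : ∀ X Y : 𝔸, ‖τ (X * Y)‖ ≤ Mτ * ‖X‖ * ‖Y‖) (hMτ : 0 ≤ Mτ) {ρw : ℝ} (hρw : 0 ≤ ρw)
  (hτ₁ : ∀ X : 𝔸, τ (star X) = conj (τ X)) (hτ₂ : ∀ X Y : 𝔸, τ (X * Y) = τ (Y * X))
  (hφτ : ∀ X Y : 𝔸, ⟪φ.symm X, φ.symm Y⟫_ℂ = τ (star X * Y))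
  (AQ : ℝ) (hAQ16 : 16 * (((4 : ℕ) : ℝ) + 1) * (((4 : ℕ) : ℝ) + 4) * c2' 4 L ≤ AQ)

include hL3 hMφ hMφ' hφ hφ' ha₁ ha₁' hτ hCτ hτm hMτ hρw hτ₁ hτ₂ hφτ hAQ16

/-- **THE (D4)-CHAIN, THE RESIDUE, B4 AND N26 AT RECORD 13 FROM A STAGE-12 [B13] FAMILY OF RECORD WITH NODE D SUPPLIED BY NE9's FLAT TOWER OPERATOR ON THE
MEMBERS' TORI** («Y19» `exists_data190_tower_flat` at `N := NOfLayers (m ↦ lamF (Ps k v m) k v)` plugged into dag-n26-c's p491248 §1b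
`exists_chainTFac190H_betaOfRecord₁₃_of_family` ∕ `atSlopeCont_betaOfRecord₁₃_of_family_leafwise` ∕ `betaContH_betaOfRecord₁₃_of_family` ∕ `n26_datumOfRecord₁₃_of_family` — the
Record-13 twin of the row-(D4) owner's p478901).  `∃ (δ⋆, C⋆)` FIRST (functions of NE9's structure data only); then for every family of tower weights per scale, cube side `M`,
size indices, block-torus geometry letters, source direction `μ₀` ∕ value `w₀`, every `q : Consts190` under NUMERICS ONLY, every Stage-13 tuple `θ`, residual letters `cR`,
Stage-12 [B13] family `lamF : ResidB13Fam₁₂ F N θ.toStage12Params`, box `γ₀ ≤ θ.γ`, leaf kernels `A1` with the (1.22) identification AT THE STAGE-13 MERGED β (canonical transport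
`TcanOfRecord`, (2.9) species `chiFixed29 θ.ν θ.ε₂₉`), the member letters law `hcF` and N10's FAMILY leaf of record `hleafF` at the Stage-12 part, run sequences `Ps k v` with
growing tori ∕ laws ∕ restriction sentences on the box, N1 ∕ N3 at the letters of record `c13OfRecord₁₂ θ.toStage12Params cR`, ANY admissible regularity display ∕ positivity
witness of `Δ_{a,k}(1)` per (k, v, m), every (4.4) seam FROM THE FINE BOND FIELDS OF THE (k+1)-STOREY TOWER over the member's torus into the member's `sp2 X` with the member's
activities holomorphic along it (on the box), and (1.7) data `V, Fw, r, hfac, t` with the test-vector limit `hconv` READ ON THE EXPLICIT FLAT (4.35) VECTORS and the read-out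
`ha` (on the box): (i) `∃ R : ChainTFac190H 4 M μ ν (split₁₃ θ) γ₀ (c13OfRecord₁₂ θ₁₂ cR) (L∕2) α₂ q` with `R.A1 = A1` and, per (k, v) in the box, the tori handle
`(R.leaves k v hv).N = m ↦ (lamF (Ps k v m) k v).n + 1` and the steps handle `(R.leaves k v hv).W ≍ …` (p491248's handles; the carriers `Bond 4 (towerP …) → W` are fixed BY
THE STATEMENT); (ii) with `Valid`, smallness `ε₁·K_rem,L∕2 ≤ s` and (C-leaf) in the (1.7) read-out letters: `AtSlopeCont (split₁₃ θ) γ₀ s` — the shape a Record-13 crux stub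
pinned on `(TcanOfRecord, chiFixed29)` reads (crux K2‴ `EndpointGivenBR13`'s (D4) side), a REDUCTION with NODE D no longer displayed, NOT a proof of it; (iii) with `Valid` and
(C-pt): `BetaContH γ₀ (betaOfRecord₁₃ F N θ)`; (iv) with `Provisos₁₃`, `Valid`, (C-pt) and `0 < γ₀`: N26 at the Stage-13 datum `∃ γc > 0, BetaContH γc (datumOfRecord₁₃ F N θ hP).βfun`.
Here `split₁₃ θ := oneLoopSplit_betaOfMerged βm₁₃ (beta0OfMerged βm₁₃ θ.v₀) θ.γ`, `βm₁₃ := betaMerged F (mergedTermFamilyMatT F N (TcanOfRecord F N) (chiFixed29 F N θ.ν θ.ε₂₉) θ.εbg) θ.ρ8 θ.bV`.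
NODE D on «Y19»'s MODEL class (zero background, one-domain tower, value line, one source direction); every other input displayed; instance 0∕1; N26 NOT discharged; by
dag-ref-D's READ-148 rule the `CondsL` hypothesis at the letters of record is VACUOUS at any witness with κ ≤ 128 (and at the faithful letters with `ε₁ := θ.ε₂₉` too large) —
meaningful for free θ ∕ `cR` only (n26-c p485881 ∕ p491248 §3).
[cite: Balaban1985Variational, (129)–(130) p.297, (190) p.308] [cite: Balaban1985BackgroundPropagators, (3.126) p.420, (3.133)–(3.134) p.422, Thm 3.11 p.416]
[cite: Balaban1984PropagatorsII, (1.103) p.36, Lemma 2.1 (2.61) p.234] [cite: Balaban1987RG1, Thm 3 p.264, (1.7) p.261, (1.20)-(1.22) p.264, (2.9) p.266, (2.12)-(2.13) p.268, (4.4) p.281, p.282, (4.35) p.290, (5.1) p.292, (5.10) p.293]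
[cite: Balaban1988RG2Cluster, (2.13) p.14, p.15, Lemma 3 (2.38) p.20 and p.21] -/
theorem exists_chainTFac190H_betaOfRecord₁₃_of_family_towerFlat :
    ∃ δs Cs : ℝ, 0 < δs ∧ 0 ≤ Cs ∧
      ∀ -- tower weights per scale `k` (height `k + 1`)
        (η : ℕ → ℝ) (_hηL : ∀ k, η k * (L : ℝ) ^ (k + 1) = 1) (c₀ c₁ : ℕ → ℝ) [∀ k, Fact (0 < c₀ k)] [∀ k, Fact (0 < c₁ k)]
        (_hw : ∀ k, c₀ k * ((L : ℝ) ^ (k + 1)) ^ 4 = c₁ k) (_hρ : ∀ k, |η k| ^ 4 / c₀ k ≤ ρw)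
        -- cube side, size indices, block-geometry letters, source direction ∕ value, the (190)-record under numerics only
        (M : ℕ) [NeZero M] (I : Type) (_i₀ : I) (η₀ L₀ M₀ Rg : ℕ → ℝ) (Hg : ℕ → Prop) (μ₀ : Fin 4) (w₀ : W)
        (q : Consts190) (δr : ℝ) (_hδr : 0 < δr) (_hσ₀ : 0 < q.σ) (_hcR : B6.c0 δr (q.σ / δr) ^ 4 ≤ q.cR) (_hκB : 1 ≤ q.κB)
        (_hδ15 : q.δ15 ≤ δs) (_hCst : Cs ≤ q.Cst) (_hmw : ‖w₀‖ ≤ q.m) (_hθ1 : q.θ ≤ 1)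
        -- the Stage-13 tuple, the residual letters, a Stage-12 [B13] FAMILY of record, the box, the leaf kernels with the (1.22) identification AT THE STAGE-13 MERGED β
        (γ₀ : ℝ) (μ ν : Fin 4) (α₂ : ℝ) (θ : Stage13Params F N) (cR : B13.Consts) (lamF : ResidB13Fam₁₂ F N θ.toStage12Params)
        (_hle : γ₀ ≤ θ.γ) (A1 : (k : ℕ) → (Fin (k + 1) → ℝ) → LDom 4 → Pt 4 → ℝ)
        (_hm : letI := θ.instVβ₁; letI := θ.instVβ₂; letI := θ.instιβ
          ∀ k (v : Fin (k + 1) → ℝ), v ∈ Box γ₀ k →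
            betaMerged F (mergedTermFamilyMatT F N (TcanOfRecord F N) (chiFixed29 F N θ.ν θ.ε₂₉) θ.εbg) θ.ρ8 θ.bV k v =
              beta0OfMerged (betaMerged F (mergedTermFamilyMatT F N (TcanOfRecord F N) (chiFixed29 F N θ.ν θ.ε₂₉) θ.εbg) θ.ρ8 θ.bV) θ.v₀ k +
                B12Beta.secondMoment (fun _ _ => limKernel (A1 k v)) μ ν)
        -- N10's in-edge in the FAMILY currency at every run and the member letters law on the box, at the Stage-12 part (letters of record `c13OfRecord₁₂ θ.toStage12Params cR`)
        (_hcF : ∀ P k v, v ∈ Box γ₀ k → (lamF P k v).c = c13OfRecord₁₂ F N θ.toStage12Params cR)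
        (_hleafF : ∀ P, B13FamLeafOfRecord₁₂ F N θ.toStage12Params cR lamF P)
        -- per (scale, history) IN THE BOX: a RUN SEQUENCE whose members AT THAT HISTORY have growing coarse tori, their laws and restriction sentences
        (Ps : (k : ℕ) → (Fin (k + 1) → ℝ) → ℕ → B12.RunParams)
        (_hn : ∀ k v, v ∈ Box γ₀ k → Tendsto (fun m => (lamF (Ps k v m) k v).n) atTop atTop)
        (_hsp : ∀ k v, v ∈ Box γ₀ k → ∀ m, SpLaw (lamF (Ps k v m) k v))
        (_h213 : ∀ k v, v ∈ Box γ₀ k → ∀ m, Law213 (lamF (Ps k v m) k v))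
        (_hR : ∀ k v, v ∈ Box γ₀ k → ∀ m, (lamF (Ps k v m) k v).Restr)
        -- N1 ∕ N3 at the LETTERS OF RECORD and ℓ = ½L
        (_hC : CondsL 4 (c13OfRecord₁₂ F N θ.toStage12Params cR) (((c13OfRecord₁₂ F N θ.toStage12Params cR).L : ℝ) / 2)) (_hs : SignsL (c13OfRecord₁₂ F N θ.toStage12Params cR) α₂ q.B₃)
        -- ANY admissible regularity display and positivity witness of `Δ_{a,k}(1)` per (k, v, m) on the tower over the member's torus
        (αU : (k : ℕ) → (Fin (k + 1) → ℝ) → ℕ → ℕ → ℝ) (hα1 : ∀ k v m j, αU k v m j ≤ 1 / 64)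
        (hαL : ∀ k v m j, 50 * (((4 : ℕ) : ℝ) + 1) * αU k v m j * (L : ℝ) ^ 4 ≤ 1 / 2)
        (hU1 : ∀ k v m (j : ℕ) (z : B7Prop1Explicit.Site 4) (κ : Fin 4),
          perCfg (towerP L (fun _ : Fin 4 => NOfLayers (fun m => lamF (Ps k v m) k v) m * M) (j + 1))
            (UlevOf L (fun _ : Fin 4 => NOfLayers (fun m => lamF (Ps k v m) k v) m * M) (k + 1) (fun _ => (1 : 𝔸ˣ)) j) z κ ∈ U1 𝔸)
        (hreg : ∀ k v m (j : ℕ) (y : TSite 4 (towerP L (fun _ : Fin 4 => NOfLayers (fun m => lamF (Ps k v m) k v) m * M) j)) (κ : Fin 4)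
          (ρ' : Fin 4 → Fin L),
          ‖((Wcx L (perCfg (towerP L (fun _ : Fin 4 => NOfLayers (fun m => lamF (Ps k v m) k v) m * M) (j + 1))
              (UlevOf L (fun _ : Fin 4 => NOfLayers (fun m => lamF (Ps k v m) k v) m * M) (k + 1) (fun _ => (1 : 𝔸ˣ)) j))
              (cornerSite L y) κ (boxVec L ρ') : 𝔸ˣ) : 𝔸) - 1‖ ≤ αU k v m j)
        (hpos : ∀ k v m (u : BondL2K ℂ 4 (towerP L (fun _ : Fin 4 => NOfLayers (fun m => lamF (Ps k v m) k v) m * M) (k + 1)) (c₀ k) W), u ≠ 0 →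
          0 < RCLike.re ⟪u, laplaceAk L (fun _ : Fin 4 => NOfLayers (fun m => lamF (Ps k v m) k v) m * M) k φ (η k) (fun _ => (1 : 𝔸ˣ)) hL
            (αU k v m) (hα1 k v m) (hU1 k v m) (hreg k v m) τ (c₀ := c₀ k) (c₁ := c₁ k) a₁ u⟫_ℂ)
        -- the (4.4) seams FROM THE TOWER's FINE BOND FIELDS into the members' spaces p. 15, the members' ACTIVITIES holomorphic along them (on the box)
        (emb : (k : ℕ) → (v : Fin (k + 1) → ℝ) → (m : ℕ) → TDom 4 ((lamF (Ps k v m) k v).n + 1) → (Bond 4 (towerP L (fun _ : Fin 4 => NOfLayers (fun m => lamF (Ps k v m) k v) m * M) (k + 1)) → W) → (lamF (Ps k v m) k v).Φ)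
        (_hemb : ∀ k v, v ∈ Box γ₀ k → ∀ m X, ∀ u ∈ ball (0 : Bond 4 (towerP L (fun _ : Fin 4 => NOfLayers (fun m => lamF (Ps k v m) k v) m * M) (k + 1)) → W) α₂, emb k v m X u ∈ (lamF (Ps k v m) k v).sp2 X)
        (_hH : ∀ k v, v ∈ Box γ₀ k → ∀ m (X Z : TDom 4 ((lamF (Ps k v m) k v).n + 1)), Z.1 ⊆ X.1 →
          DifferentiableOn ℂ (fun u => (lamF (Ps k v m) k v).H Z (emb k v m X u)) (ball 0 α₂))
        -- the (1.7) ∕ test-vector-limit data (on the box), the limit READ ON THE EXPLICIT FLAT TEST VECTORS, and the read-out of the leaf kernels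
        (V : (k : ℕ) → (Fin (k + 1) → ℝ) → LDom 4 → Type) (_instV : ∀ k v Y, NormedAddCommGroup (V k v Y))
        (_instVs : ∀ k v Y, NormedSpace ℂ (V k v Y))
        (Fw : (k : ℕ) → (v : Fin (k + 1) → ℝ) → (Y : LDom 4) → V k v Y → ℂ)
        (_hFd : ∀ k v, v ∈ Box γ₀ k → ∀ Y, ∃ ρ > 0, DifferentiableOn ℂ (Fw k v Y) (ball 0 ρ))
        (r : (k : ℕ) → (v : Fin (k + 1) → ℝ) → (m : ℕ) → (Y : LDom 4) → (Bond 4 (towerP L (fun _ : Fin 4 => NOfLayers (fun m => lamF (Ps k v m) k v) m * M) (k + 1)) → W) →L[ℂ] V k v Y)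
        (_hfac : ∀ k v, v ∈ Box γ₀ k → ∀ Y : LDom 4, ∀ᶠ m in atTop, ∀ u ∈ ball (0 : Bond 4 (towerP L (fun _ : Fin 4 => NOfLayers (fun m => lamF (Ps k v m) k v) m * M) (k + 1)) → W) α₂,
          (lamF (Ps k v m) k v).Ek1 (tproj ((lamF (Ps k v m) k v).n + 1) Y) (emb k v m (tproj ((lamF (Ps k v m) k v).n + 1) Y) u) = Fw k v Y (r k v m Y u))
        (t : (k : ℕ) → (v : Fin (k + 1) → ℝ) → (Y : LDom 4) → Pt 4 → V k v Y)
        (_hconv : ∀ k v, v ∈ Box γ₀ k → ∀ (Y : LDom 4) (x : Pt 4),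
          Tendsto (fun m => r k v m Y
            (fun b : Bond 4 (towerP L (fun _ : Fin 4 => NOfLayers (fun m => lamF (Ps k v m) k v) m * M) (k + 1)) =>
              if tcubeOf (NOfLayers (fun m => lamF (Ps k v m) k v) m) M (fun i => ((blockCoord (L ^ (k + 1)) (fun _ : Fin 4 => NOfLayers (fun m => lamF (Ps k v m) k v) m * M)
                    (siteCast (towerP_eq_fineP_pow L (fun _ : Fin 4 => NOfLayers (fun m => lamF (Ps k v m) k v) m * M) (k + 1)) (bpos b)) i : ℕ) :
                      ZMod (NOfLayers (fun m => lamF (Ps k v m) k v) m * M))) ∈ (tproj ((lamF (Ps k v m) k v).n + 1) Y).1 then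
                ((WL2.linearEquiv ℂ ℂ (fun _ : Bond 4 (towerP L (fun _ : Fin 4 => NOfLayers (fun m => lamF (Ps k v m) k v) m * M) (k + 1)) => c₀ k) :
                    BondL2K ℂ 4 (towerP L (fun _ : Fin 4 => NOfLayers (fun m => lamF (Ps k v m) k v) m * M) (k + 1)) (c₀ k) W ≃ₗ[ℂ] (Bond 4 (towerP L (fun _ : Fin 4 => NOfLayers (fun m => lamF (Ps k v m) k v) m * M) (k + 1)) → W))
                  (H1k L (fun _ : Fin 4 => NOfLayers (fun m => lamF (Ps k v m) k v) m * M) k φ (η k) (fun _ => (1 : 𝔸ˣ)) hL (αU k v m) (hα1 k v m)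
                    (hU1 k v m) (hreg k v m) τ (c₀ := c₀ k) (c₁ := c₁ k) (hαL k v m) (hpos k v m)
                    ((WL2.linearEquiv ℂ ℂ (fun _ : Bond 4 (fun _ : Fin 4 => NOfLayers (fun m => lamF (Ps k v m) k v) m * M) => c₁ k) :
                        BondL2K ℂ 4 (fun _ : Fin 4 => NOfLayers (fun m => lamF (Ps k v m) k v) m * M) (c₁ k) W ≃ₗ[ℂ]
                          (Bond 4 (fun _ : Fin 4 => NOfLayers (fun m => lamF (Ps k v m) k v) m * M) → W)).symm
                      (Pi.single ((fun i => (⟨((proj (((lamF (Ps k v m) k v).n + 1) * M) x) i).val,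
                          ZMod.val_lt ((proj (((lamF (Ps k v m) k v).n + 1) * M) x) i)⟩ : Fin (NOfLayers (fun m => lamF (Ps k v m) k v) m * M))), μ₀) w₀)))) b
              else 0)) atTop (𝓝 (t k v Y x)))
        (_ha : ∀ k v, v ∈ Box γ₀ k → ∀ (Y : LDom 4) (z : Pt 4), A1 k v Y z = (mixedDeriv (Fw k v Y) (t k v Y 0) (t k v Y z)).re),
      (letI := θ.instVβ₁; letI := θ.instVβ₂; letI := θ.instιβ
        ∃ R : ChainTFac190H 4 M μ ν
            (oneLoopSplit_betaOfMerged
              (betaMerged F (mergedTermFamilyMatT F N (TcanOfRecord F N) (chiFixed29 F N θ.ν θ.ε₂₉) θ.εbg) θ.ρ8 θ.bV)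
              (beta0OfMerged (betaMerged F (mergedTermFamilyMatT F N (TcanOfRecord F N) (chiFixed29 F N θ.ν θ.ε₂₉) θ.εbg) θ.ρ8 θ.bV)
                θ.v₀) θ.γ)
            γ₀ (c13OfRecord₁₂ F N θ.toStage12Params cR) (((c13OfRecord₁₂ F N θ.toStage12Params cR).L : ℝ) / 2) α₂ q,
          R.A1 = A1 ∧ ∀ k (v : Fin (k + 1) → ℝ) (hv : v ∈ B12Beta.HistBox γ₀ k),
            (R.leaves k v hv).N = (fun m => (lamF (Ps k v m) k v).n + 1) ∧
              HEq (R.leaves k v hv).W (fun m => (WtOfRecord θ.toStage3Params (lamF (Ps k v m) k v)).toTorusStep)) ∧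
        (∀ (_hq : q.Valid (c13OfRecord₁₂ F N θ.toStage12Params cR).δ₀) (s : ℝ)
          (_hsmall : (c13OfRecord₁₂ F N θ.toStage12Params cR).ε₁ * remCoeffL 4 M (c13OfRecord₁₂ F N θ.toStage12Params cR) α₂ q.B₃ ≤ s)
          (_hcont : ∀ k (Y : LDom 4) (z : Pt 4),
            ContinuousOn (fun v : Fin (k + 1) → ℝ => (mixedDeriv (Fw k v Y) (t k v Y 0) (t k v Y z)).re) (Box γ₀ k)),
          letI := θ.instVβ₁; letI := θ.instVβ₂; letI := θ.instιβ
          AtSlopeCont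
            (oneLoopSplit_betaOfMerged
              (betaMerged F (mergedTermFamilyMatT F N (TcanOfRecord F N) (chiFixed29 F N θ.ν θ.ε₂₉) θ.εbg) θ.ρ8 θ.bV)
              (beta0OfMerged (betaMerged F (mergedTermFamilyMatT F N (TcanOfRecord F N) (chiFixed29 F N θ.ν θ.ε₂₉) θ.εbg) θ.ρ8 θ.bV)
                θ.v₀) θ.γ)
            γ₀ s) ∧
        (∀ (_hq : q.Valid (c13OfRecord₁₂ F N θ.toStage12Params cR).δ₀)
          (_hcpt : ∀ k (x : Pt 4), ContinuousOn (fun v : Fin (k + 1) → ℝ => limKernel (A1 k v) x) (Box γ₀ k)),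
          BetaContH γ₀ (betaOfRecord₁₃ F N θ)) ∧
        (∀ (hP : θ.Provisos₁₃ F N) (_hq : q.Valid (c13OfRecord₁₂ F N θ.toStage12Params cR).δ₀)
          (_hcpt : ∀ k (x : Pt 4), ContinuousOn (fun v : Fin (k + 1) → ℝ => limKernel (A1 k v) x) (Box γ₀ k)) (_hγ₀ : 0 < γ₀),
          ∃ γc : ℝ, 0 < γc ∧ BetaContH γc (datumOfRecord₁₃ F N θ hP).βfun) := by
  -- «Y19»: the thresholds of NE9's structure data, and per (height, volume sequence) the datum with its (4.35) computation rule
  obtain ⟨δs, Cs, hδs, hCs, HY⟩ :=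
    exists_data190_tower_flat (d := 4) (by norm_num) L hL hL3 φ hMφ hMφ' hφ hφ' ha₁ ha₁' τ hτ hCτ hτm hMτ hρw hτ₁ hτ₂ hφτ
      AQ hAQ16
  refine ⟨δs, Cs, hδs, hCs, ?_⟩
  intro η hηL c₀ c₁ _ _ hw hρ M _ I i₀ η₀ L₀ M₀ Rg Hg μ₀ w₀ q δr hδr hσ₀ hcR hκB hδ15 hCst hmw hθ1 γ₀ μ ν α₂ θ cR lamF hle A1 hm hcF
    hleafF Ps hn hsp h213 hR hC hs αU hα1 hαL hU1 hreg hpos emb hemb hH V instV instVs Fw hFd r hfac t hconv ha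
  -- NODE D per (k, v): «Y19» at height `k` on the members' tori `NOfLayers (m ↦ lamF (Ps k v m) k v)`
  choose D hD using fun (k : ℕ) (v : Fin (k + 1) → ℝ) =>
    HY k (η k) (hηL k) (c₀ k) (c₁ k) (hw k) (hρ k) M (NOfLayers fun m => lamF (Ps k v m) k v) I i₀ η₀ L₀ M₀ Rg Hg μ₀ w₀ q δr hδr
      hσ₀ hcR hκB hδ15 hCst hmw hθ1
  -- the consumer's test-vector limit, transported from the explicit flat vectors to `(D k v).hn` by the computation rule
  have hconv' : ∀ k (v : Fin (k + 1) → ℝ), v ∈ Box γ₀ k → ∀ (Y : LDom 4) (x : Pt 4),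
      Tendsto (fun m => r k v m Y ((D k v).hn m (tproj ((lamF (Ps k v m) k v).n + 1) Y) (proj (((lamF (Ps k v m) k v).n + 1) * M) x)))
        atTop (𝓝 (t k v Y x)) := fun k v hv Y x =>
    (hconv k v hv Y x).congr fun m => by
      rw [hD k v m (tproj ((lamF (Ps k v m) k v).n + 1) Y) (proj (((lamF (Ps k v m) k v).n + 1) * M) x) (αU k v m) (hα1 k v m)
        (hαL k v m) (hU1 k v m) (hreg k v m) (hpos k v m)]
  refine ⟨?_, fun hq s hsmall hcont => ?_, fun hq hcpt => ?_, fun hP hq hcpt hγ₀ => ?_⟩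
  · obtain ⟨R, hA, hNW⟩ := exists_chainTFac190H_betaOfRecord₁₃_of_family F N θ cR lamF hle A1 hm hcF hleafF Ps hn hsp h213 hR hC hs
      (fun k v m => Bond 4 (towerP L (fun _ : Fin 4 => NOfLayers (fun m => lamF (Ps k v m) k v) m * M) (k + 1)) → W) (fun _ _ _ => inferInstance) (fun _ _ _ => inferInstance) emb hemb hH D V instV instVs Fw
      hFd r hfac t hconv' ha
    exact ⟨R, hA, hNW⟩
  · exact atSlopeCont_betaOfRecord₁₃_of_family_leafwise F N θ cR lamF hle A1 hm hcF hleafF Ps hn hsp h213 hR hC hs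
      (fun k v m => Bond 4 (towerP L (fun _ : Fin 4 => NOfLayers (fun m => lamF (Ps k v m) k v) m * M) (k + 1)) → W) (fun _ _ _ => inferInstance) (fun _ _ _ => inferInstance) emb hemb hH D V instV instVs Fw
      hFd r hfac t hconv' ha hq hsmall hcont
  · exact betaContH_betaOfRecord₁₃_of_family F N θ cR lamF hle A1 hm hcF hleafF Ps hn hsp h213 hR hC hs
      (fun k v m => Bond 4 (towerP L (fun _ : Fin 4 => NOfLayers (fun m => lamF (Ps k v m) k v) m * M) (k + 1)) → W) (fun _ _ _ => inferInstance) (fun _ _ _ => inferInstance) emb hemb hH D V instV instVs Fw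
      hFd r hfac t hconv' ha hq hcpt
  · exact n26_datumOfRecord₁₃_of_family F N θ cR lamF hle A1 hm hcF hleafF Ps hn hsp h213 hR hC hs
      (fun k v m => Bond 4 (towerP L (fun _ : Fin 4 => NOfLayers (fun m => lamF (Ps k v m) k v) m * M) (k + 1)) → W) (fun _ _ _ => inferInstance) (fun _ _ _ => inferInstance) emb hemb hH D V instV instVs Fw
      hFd r hfac t hconv' ha hP hq hcpt hγ₀

end FamilyTowerFlat

end Summit.QuantumFields.YangMills.Theorems.BalabanUVNodesN26AtRecord13FamilyTowerFlat

end
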